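import Summits.CriticalPhenomena.PercolationContinuityZ3.Theorems.Transplant.FKConnectivityAllQForestAdjacentSeparatorTransfer
import HarnessLib

/-!
# The DENSE-SEPARATOR equality (all `|S|`) and the TIGHT-SET equality for the square-free adjacent forest node

builds on p205010 (kernel theorem, internal audit signed; external expert review pending).  No definitions, no named facts, no sorries;
standard axioms.

Node `FK.AdjForestRayleighNoSqOn` (vertex form: for a uniform ordered pair `(A, B)` of edge-disjoint forests of a multigraph `G'` with
union `E(G')`, `P(e, f same colour) ≤ 1/2` for adjacent `e = ov`, `f = oy`).  This file derives the two EQUALITY mechanisms of the node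
(memo bschramm/FROM-fk-1-g19-ADVERSARIAL.md §2f, Conjecture E; FK-DEFS §24) from the general transfer theorem
`adjForestNoSq_fibre_eq_of_sepTrace` (`…ForestAdjacentSeparatorTransfer`) by COUNTING inside the separator:
* `ncard_add_ncard_le_of_inside` (+ one/two/three-point forms, `reachable_of_inside_of_ncard`) — a forest with pairs inside `S` and
  `m` pairwise non-joined points of `S` has at most `|S| - m` pairs (`|T| + k(T) = |V|`, distinct clusters);
* `not_reachable_of_disjoint_join` — two disjoint parts of a forest cannot both join `p ≠ p'` (remove the first pair of a path);
* `gadget_ncard_add_two_le` / `gadget_ncard_add_three_le` — a colour class joining two points of `S` inside one side (inside both sides)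
  has at most `|S| - 2` (`|S| - 3`) gadget pairs;
* `sepTrace_dichotomy_of_dense` — the GADGET LEMMA for every `|S|`: if `S` spans at least `2|S| - 3` pairs of the fibre (doubled pairs
  twice), at most one of the four side classes of a valid colouring joins two points of `S`, so the trace dichotomy holds;
* **`adjForestNoSq_fibre_eq_of_denseSep`** — THE DENSE-SEPARATOR EQUALITY for all `|S|` (g18 p323201 `|S| = 1`, g19 p328146 `|S| = 2`,
  p329067 `|S| = 3` are the first cases): a set `S ∋ o` separating `v` from `y` with `|E(S)| ≥ 2|S| - 3` forces `bad = good`;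
* **`adjForestNoSq_fibre_eq_of_tightSet`** — THE TIGHT-SET EQUALITY (memo bschramm/FROM-fk-1-g18-VERTEX-NC.md §4c(ii), paper-level
  until now): `e` inside a set `U` spanning exactly `2|U| - 2` pairs and `f` outside force `bad = good` (both classes restricted to `U`
  are spanning trees of `U`, so the side-1 traces are both indiscrete).
Together: every equality of the node observed in the g18/g19 censuses (all graphs with `n ≤ 10`, samples to `n = 14`; Conjecture E says
there are no others) is an instance of ONE kernel theorem. [cite: Grimmett2006, §1.5 (p. 13); §3.8 (pp. 61–62)]
[cite: SempleWelsh2008, Conj. 1.1 (p. 2)] [cite: Linusson2011, Prop. 2.6]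
-/

noncomputable section

namespace Summit.CriticalPhenomena.PercolationContinuityZ3.Theorems

namespace FK

open Set SimpleGraph Literature.Probability.LatticeModels Literature.Probability.Percolation
open scoped Classical

variable {V : Type*} [Fintype V]

section DenseSep

open scoped symmDiff

/-! ### Counting configurations inside the separator -/

/-- **Pairwise non-joined points lie in distinct clusters**: if no two distinct points of `Y` are joined in `⟨T⟩`, then `|Y| ≤ k(T)`.
[cite: Grimmett2006, §1.5 (p. 13)] -/
theorem ncard_le_clusterCount_of_pairwise {T : BondConfig V} {Y : Set V}
    (hY : ∀ x ∈ Y, ∀ y' ∈ Y, (openGraph T).Reachable x y' → x = y') : Y.ncard ≤ clusterCount T ∅ := by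
  have hk : clusterCount T ∅ = (Set.univ : Set (openGraph T).ConnectedComponent).ncard := by
    unfold clusterCount; rw [wired_empty, sup_bot_eq, Set.ncard_univ]
  rw [hk]
  refine Set.ncard_le_ncard_of_injOn (fun x => (openGraph T).connectedComponentMk x) (fun _ _ => Set.mem_univ _)
    (fun x hx y' hy' hxy => ?_) (Set.toFinite _)
  exact hY x hx y' hy' (SimpleGraph.ConnectedComponent.eq.1 hxy)

/-- **A forest inside `S` leaves room**: if the pairs of the forest `T` lie inside `S` and the points of `P ⊆ S` are pairwise not joined
in `⟨T⟩`, then `|T| + |P| ≤ |S|` (the points off `S` and the points of `P` lie in distinct clusters, and `|T| + k(T) = |V|`).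
[cite: Grimmett2006, §1.5 (p. 13)] -/
theorem ncard_add_ncard_le_of_inside {T : BondConfig V} {S P : Set V} (hT : ∀ e ∈ T, ∀ z ∈ e, z ∈ S) (hF : IsForestCfg T)
    (hPS : P ⊆ S) (hP : ∀ x ∈ P, ∀ y' ∈ P, (openGraph T).Reachable x y' → x = y') : T.ncard + P.ncard ≤ S.ncard := by
  -- a point off `S` is joined to nothing else
  have hoff : ∀ x, x ∉ S → ∀ y', (openGraph T).Reachable x y' → x = y' := by
    intro x hx y' h
    obtain ⟨w⟩ := h
    cases w with
    | nil => rfl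
    | cons hadj _ =>
      exact absurd (hT _ ((openGraph_adj T _ _).1 hadj).1 x (Sym2.mem_mk_left _ _)) hx
  have hY : ∀ x ∈ Sᶜ ∪ P, ∀ y' ∈ Sᶜ ∪ P, (openGraph T).Reachable x y' → x = y' := by
    rintro x (hx | hx) y' hy' h
    · exact hoff x hx y' h
    · rcases hy' with hy' | hy'
      · exact (hoff y' hy' x h.symm).symm
      · exact hP x hx y' hy' h
  have hle := ncard_le_clusterCount_of_pairwise hY
  have hdisj : Disjoint Sᶜ P := Set.disjoint_left.2 fun x hx hxP => hx (hPS hxP)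
  rw [Set.ncard_union_eq hdisj (toFinite _) (toFinite _)] at hle
  have hc := Set.ncard_add_ncard_compl S
  rw [Nat.card_eq_fintype_card] at hc
  have hFc := (isForestCfg_iff_ncard_add T).1 hF
  omega

/-- One point: a forest inside `S ∋ p` has at most `|S| - 1` pairs. [cite: Grimmett2006, §1.5 (p. 13)] -/
theorem ncard_add_one_le_of_inside {T : BondConfig V} {S : Set V} (hT : ∀ e ∈ T, ∀ z ∈ e, z ∈ S) (hF : IsForestCfg T) {p : V}
    (hp : p ∈ S) : T.ncard + 1 ≤ S.ncard := by
  have h := ncard_add_ncard_le_of_inside hT hF (P := {p}) (Set.singleton_subset_iff.2 hp) (fun x hx y' hy' _ => by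
    rw [Set.mem_singleton_iff.1 hx, Set.mem_singleton_iff.1 hy'])
  rwa [Set.ncard_singleton] at h

/-- Two points: if `p ≠ p'` in `S` are not joined in the forest `T` inside `S`, then `|T| + 2 ≤ |S|`. [cite: Grimmett2006, §1.5 (p. 13)] -/
theorem ncard_add_two_le_of_inside {T : BondConfig V} {S : Set V} (hT : ∀ e ∈ T, ∀ z ∈ e, z ∈ S) (hF : IsForestCfg T) {p p' : V}
    (hp : p ∈ S) (hp' : p' ∈ S) (hne : p ≠ p') (hn : ¬ (openGraph T).Reachable p p') : T.ncard + 2 ≤ S.ncard := by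
  have hPS : ({p, p'} : Set V) ⊆ S := Set.insert_subset hp (Set.singleton_subset_iff.2 hp')
  have h := ncard_add_ncard_le_of_inside hT hF hPS (fun x hx y' hy' hxy => by
    simp only [Set.mem_insert_iff, Set.mem_singleton_iff] at hx hy'
    rcases hx with rfl | rfl <;> rcases hy' with rfl | rfl
    · rfl
    · exact absurd hxy hn
    · exact absurd hxy.symm hn
    · rfl)
  rwa [Set.ncard_pair hne] at h

/-- Three points: if `a, b, c ∈ S` are pairwise not joined in the forest `T` inside `S`, then `|T| + 3 ≤ |S|`.
[cite: Grimmett2006, §1.5 (p. 13)] -/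
theorem ncard_add_three_le_of_inside {T : BondConfig V} {S : Set V} (hT : ∀ e ∈ T, ∀ z ∈ e, z ∈ S) (hF : IsForestCfg T)
    {a b c : V} (ha : a ∈ S) (hb : b ∈ S) (hc : c ∈ S) (hab : ¬ (openGraph T).Reachable a b)
    (hac : ¬ (openGraph T).Reachable a c) (hbc : ¬ (openGraph T).Reachable b c) : T.ncard + 3 ≤ S.ncard := by
  have hab' : a ≠ b := fun h => hab (h ▸ SimpleGraph.Reachable.refl _)
  have hac' : a ≠ c := fun h => hac (h ▸ SimpleGraph.Reachable.refl _)
  have hbc' : b ≠ c := fun h => hbc (h ▸ SimpleGraph.Reachable.refl _)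
  have hPS : ({a, b, c} : Set V) ⊆ S := Set.insert_subset ha (Set.insert_subset hb (Set.singleton_subset_iff.2 hc))
  have h := ncard_add_ncard_le_of_inside hT hF hPS (fun x hx y' hy' hxy => by
    simp only [Set.mem_insert_iff, Set.mem_singleton_iff] at hx hy'
    rcases hx with rfl | rfl | rfl <;> rcases hy' with rfl | rfl | rfl
    · rfl
    · exact absurd hxy hab
    · exact absurd hxy hac
    · exact absurd hxy.symm hab
    · rfl
    · exact absurd hxy hbc
    · exact absurd hxy.symm hac
    · exact absurd hxy.symm hbc
    · rfl)
  have h3 : ({a, b, c} : Set V).ncard = 3 := Set.ncard_eq_three.2 ⟨a, b, c, hab', hac', hbc', rfl⟩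
  rwa [h3] at h

/-- **A full forest inside `S` connects `S`**: if the forest `T` inside `S` has `|S| - 1` pairs (`|S| ≤ |T| + 1`), any two points of `S` are
joined in `⟨T⟩`. [cite: Grimmett2006, §1.5 (p. 13)] -/
theorem reachable_of_inside_of_ncard {T : BondConfig V} {S : Set V} (hT : ∀ e ∈ T, ∀ z ∈ e, z ∈ S) (hF : IsForestCfg T)
    (hfull : S.ncard ≤ T.ncard + 1) {p p' : V} (hp : p ∈ S) (hp' : p' ∈ S) : (openGraph T).Reachable p p' := by
  by_cases hne : p = p'
  · subst hne; exact SimpleGraph.Reachable.refl _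
  by_contra hn
  have h := ncard_add_two_le_of_inside hT hF hp hp' hne hn
  omega

/-! ### Two disjoint joins close a cycle -/

omit [Fintype V] in
/-- **Two disjoint joins close a cycle**: if `T, Z ⊆ X` are disjoint parts of a forest `X` and `Z` joins `p ≠ p'`, then `T` does not
join `p` to `p'` (take a `T`-path `p p₁ … p'`; removing its first pair `pp₁` from `X` still leaves `p₁` joined to `p` through the rest
of the path and `Z`, so `pp₁` closed a cycle). [cite: Grimmett2006, §1.5 (p. 13)] -/
theorem not_reachable_of_disjoint_join {X T Z : BondConfig V} (hX : IsForestCfg X) (hTX : T ⊆ X) (hZX : Z ⊆ X) (hTZ : Disjoint T Z)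
    {p p' : V} (hne : p ≠ p') (hZ : (openGraph Z).Reachable p p') : ¬ (openGraph T).Reachable p p' := by
  rintro ⟨w⟩
  have key : ∀ q : (openGraph T).Walk p p', q.IsPath → False := by
    intro q hq
    cases q with
    | nil => exact hne rfl
    | @cons _ x _ hadj q' =>
      obtain ⟨hpx, hpxne⟩ := (openGraph_adj T p x).1 hadj
      have hnotin : s(p, x) ∉ q'.edges := by
        have hnd := hq.isTrail.edges_nodup
        rw [SimpleGraph.Walk.edges_cons, List.nodup_cons] at hnd
        exact hnd.1
      set X' : BondConfig V := X \ {s(p, x)} with hX'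
      have hgX' : s(p, x) ∉ X' := fun h => h.2 rfl
      have hins : insert s(p, x) X' = X := by
        rw [hX', Set.insert_sdiff_singleton, Set.insert_eq_of_mem (hTX hpx)]
      -- the rest of the path lives in `X'`
      have hedges : ∀ e, e ∈ q'.edges → e ∈ (openGraph X').edgeSet := by
        intro e he
        have he' := q'.edges_subset_edgeSet he
        rw [openGraph, SimpleGraph.edgeSet_fromEdgeSet] at he' ⊢
        exact ⟨⟨hTX he'.1, fun h => hnotin (Set.mem_singleton_iff.1 h ▸ he)⟩, he'.2⟩
      have r₁ : (openGraph X').Reachable x p' := ⟨q'.transfer (openGraph X') hedges⟩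
      -- `Z` lives in `X'`
      have hZX' : Z ⊆ X' := fun z hz =>
        ⟨hZX hz, fun h => Set.disjoint_left.1 hTZ hpx (Set.mem_singleton_iff.1 h ▸ hz)⟩
      have r₂ : (openGraph X').Reachable p p' := hZ.mono (openGraph_mono hZX')
      have hXF : IsForestCfg (insert s(p, x) X') := by rw [hins]; exact hX
      exact ((isForestCfg_insert_iff hpxne hgX').1 hXF).2 (r₂.trans r₁.symm)
  exact key w.bypass w.bypass_isPath

/-! ### The gadget of a colour class is small when a side class joins two points of `S` -/

variable {E₁ E₂ ES : Set (Sym2 V)} {V₁ V₂ S : Set V} {M u₀ : BondConfig V} {o v y : V}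

/-- **One side join costs the gadget two pairs**: if a colour class `X` (a forest) joins `p ≠ p'` of `S` inside a side `E'` disjoint from
the gadget `ES` (pairs inside `S`), then `|X ∩ ES| + 2 ≤ |S|`. [cite: Grimmett2006, §1.5 (p. 13); §3.8 (pp. 61–62)] -/
theorem gadget_ncard_add_two_le (hES : ∀ e ∈ ES, ∀ z ∈ e, z ∈ S) {E' : Set (Sym2 V)} (hdS : Disjoint ES E') {X : BondConfig V}
    (hX : IsForestCfg X) {p p' : V} (hp : p ∈ S) (hp' : p' ∈ S) (hne : p ≠ p') (hj : (openGraph (X ∩ E')).Reachable p p') :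
    (X ∩ ES).ncard + 2 ≤ S.ncard :=
  ncard_add_two_le_of_inside (fun e he z hz => hES e he.2 z hz) (isForestCfg_of_subset hX inter_subset_left) hp hp' hne
    (not_reachable_of_disjoint_join hX inter_subset_left inter_subset_left
      (Set.disjoint_of_subset inter_subset_right inter_subset_right hdS) hne hj)

/-- **Two side joins on opposite sides cost the gadget three pairs**: if a colour class `X` joins `p ≠ p'` of `S` inside side 1 and
`r ≠ r'` inside side 2, then `|X ∩ ES| + 3 ≤ |S|`.  (Otherwise `X ∩ ES` has exactly two clusters meeting `S`; `p, p'` lie in different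
ones and so do `r, r'`, which joins `r` to `r'` through `X ∩ (ES ∪ E₁)` — a second, disjoint join.) [cite: Grimmett2006, §1.5 (p. 13); §3.8 (pp. 61–62)] -/
theorem gadget_ncard_add_three_le (hES : ∀ e ∈ ES, ∀ z ∈ e, z ∈ S) (hd : Disjoint E₁ E₂) (hd₁ : Disjoint ES E₁)
    (hd₂ : Disjoint ES E₂) {X : BondConfig V} (hX : IsForestCfg X) {p p' r r' : V} (hp : p ∈ S) (hp' : p' ∈ S) (hr : r ∈ S)
    (hr' : r' ∈ S) (hne : p ≠ p') (hne' : r ≠ r') (hj₁ : (openGraph (X ∩ E₁)).Reachable p p')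
    (hj₂ : (openGraph (X ∩ E₂)).Reachable r r') : (X ∩ ES).ncard + 3 ≤ S.ncard := by
  set T : BondConfig V := X ∩ ES with hTdef
  have hT : ∀ e ∈ T, ∀ z ∈ e, z ∈ S := fun e he z hz => hES e he.2 z hz
  have hTF : IsForestCfg T := isForestCfg_of_subset hX inter_subset_left
  by_contra hlt
  -- no three pairwise non-joined points of `S` in `⟨T⟩`
  have ntp : ∀ a ∈ S, ∀ b ∈ S, ∀ c ∈ S,
      (openGraph T).Reachable a b ∨ (openGraph T).Reachable a c ∨ (openGraph T).Reachable b c := by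
    intro a ha b hb c hc
    by_contra h
    simp only [not_or] at h
    exact hlt (ncard_add_three_le_of_inside hT hTF ha hb hc h.1 h.2.1 h.2.2)
  -- the two side joins are not doubled by the gadget
  have hnp : ¬ (openGraph T).Reachable p p' :=
    not_reachable_of_disjoint_join hX inter_subset_left inter_subset_left
      (Set.disjoint_of_subset inter_subset_right inter_subset_right hd₁) hne hj₁
  have hnr : ¬ (openGraph T).Reachable r r' :=
    not_reachable_of_disjoint_join hX inter_subset_left inter_subset_left
      (Set.disjoint_of_subset inter_subset_right inter_subset_right hd₂) hne' hj₂
  -- joining `r` to `r'` through the gadget and side 1 contradicts the side-2 join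
  have hsub : T ∪ X ∩ E₁ ⊆ X := union_subset inter_subset_left inter_subset_left
  have hdisj : Disjoint (T ∪ X ∩ E₁) (X ∩ E₂) := by
    refine Set.disjoint_left.2 ?_
    rintro x (⟨-, hx⟩ | ⟨-, hx⟩) ⟨-, hx2⟩
    · exact Set.disjoint_left.1 hd₂ hx hx2
    · exact Set.disjoint_left.1 hd hx hx2
  have hnr' : ¬ (openGraph (T ∪ X ∩ E₁)).Reachable r r' :=
    not_reachable_of_disjoint_join hX hsub inter_subset_left hdisj hne' hj₂
  have mT : ∀ {a b : V}, (openGraph T).Reachable a b → (openGraph (T ∪ X ∩ E₁)).Reachable a b :=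
    fun h => h.mono (openGraph_mono subset_union_left)
  have m₁ : (openGraph (T ∪ X ∩ E₁)).Reachable p p' := hj₁.mono (openGraph_mono subset_union_right)
  rcases ntp p hp p' hp' r hr with h | hpr | hp'r
  · exact hnp h
  · rcases ntp p hp p' hp' r' hr' with h | hpr' | hp'r'
    · exact hnp h
    · exact hnr (hpr.symm.trans hpr')
    · exact hnr' ((mT hpr.symm).trans (m₁.trans (mT hp'r')))
  · rcases ntp p hp p' hp' r' hr' with h | hpr' | hp'r'
    · exact hnp h
    · exact hnr' ((mT hp'r.symm).trans (m₁.symm.trans (mT hpr')))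
    · exact hnr (hp'r.symm.trans hp'r')

/-! ### Density forces the trace dichotomy -/

/-- **The gadget pairs of the two classes**: on the fibre `(M', u₀)` with `ES ⊆ M' ∪ u₀`, the gadget parts `ω ∩ ES`, `(ω ∆ M') ∩ ES` of a
colouring satisfy `|ES| + |ES ∩ u₀| ≤ |ω ∩ ES| + |(ω ∆ M') ∩ ES|` (every gadget pair is in a class, the doubled ones in both).
[cite: Linusson2011, Prop. 2.6] -/
theorem gadget_ncard_add_le {M' : BondConfig V} (hESsub : ES ⊆ M' ∪ u₀) {ω : BondConfig V} (hω : ω \ M' = u₀) :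
    ES.ncard + (ES ∩ u₀).ncard ≤ (ω ∩ ES).ncard + ((ω ∆ M') ∩ ES).ncard := by
  have hu₀ω : u₀ ⊆ ω := fun x hx => (hω ▸ hx : x ∈ ω \ M').1
  have hu₀M : ∀ x ∈ u₀, x ∉ M' := fun x hx => (hω ▸ hx : x ∈ ω \ M').2
  have hcover : ES ⊆ ω ∩ ES ∪ (ω ∆ M') ∩ ES := by
    intro x hx
    rcases hESsub hx with hxM | hxu
    · by_cases hxω : x ∈ ω
      · exact Or.inl ⟨hxω, hx⟩
      · exact Or.inr ⟨Set.mem_symmDiff.2 (Or.inr ⟨hxM, hxω⟩), hx⟩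
    · exact Or.inl ⟨hu₀ω hxu, hx⟩
  have hboth : ES ∩ u₀ ⊆ ω ∩ ES ∩ ((ω ∆ M') ∩ ES) := fun x hx =>
    ⟨⟨hu₀ω hx.2, hx.1⟩, Set.mem_symmDiff.2 (Or.inl ⟨hu₀ω hx.2, hu₀M x hx.2⟩), hx.1⟩
  have h1 := Set.ncard_le_ncard hcover (toFinite _)
  have h2 := Set.ncard_le_ncard hboth (toFinite _)
  have h3 := Set.ncard_union_add_ncard_inter (ω ∩ ES) ((ω ∆ M') ∩ ES) (toFinite _) (toFinite _)
  omega

/-- **Density forces the trace dichotomy** (the gadget lemma of memo bschramm/FROM-fk-1-g19-ADVERSARIAL.md §2f(ii), all `|S|`).  On a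
fibre `(M', u₀)` whose gadget `ES` (pairs inside `S`, disjoint from the sides `E₁`, `E₂`, themselves disjoint) lies in the fibre and is
DENSE — `2|S| ≤ |ES| + |ES ∩ u₀| + 3`, i.e. `|E(S)| ≥ 2|S| - 3` with the doubled pairs counted twice — every valid colouring has at most
one of its four side classes joining two points of `S`; in particular the two side-2 classes have the same (discrete) trace on `S`, or
the two side-1 classes do. [cite: Grimmett2006, §1.5 (p. 13); §3.8 (pp. 61–62)] [cite: Linusson2011, Prop. 2.6] -/
theorem sepTrace_dichotomy_of_dense (hES : ∀ e ∈ ES, ∀ z ∈ e, z ∈ S) (hd : Disjoint E₁ E₂) (hd₁ : Disjoint ES E₁)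
    (hd₂ : Disjoint ES E₂) {M' : BondConfig V} (hESsub : ES ⊆ M' ∪ u₀) (hdense : 2 * S.ncard ≤ ES.ncard + (ES ∩ u₀).ncard + 3)
    {ω : BondConfig V} (hω : ω \ M' = u₀) (hF : IsForestCfg ω) (hFB : IsForestCfg (ω ∆ M')) :
    (∀ x ∈ S, ∀ y' ∈ S, (openGraph (ω ∩ E₂)).Reachable x y' ↔ (openGraph ((ω ∆ M') ∩ E₂)).Reachable x y') ∨
    (∀ x ∈ S, ∀ y' ∈ S, (openGraph (ω ∩ E₁)).Reachable x y' ↔ (openGraph ((ω ∆ M') ∩ E₁)).Reachable x y') := by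
  have hsum := gadget_ncard_add_le hESsub hω
  -- discreteness of a trace, and how two discrete traces agree
  have agree : ∀ {Z Z' : BondConfig V}, (∀ x ∈ S, ∀ y' ∈ S, (openGraph Z).Reachable x y' → x = y') →
      (∀ x ∈ S, ∀ y' ∈ S, (openGraph Z').Reachable x y' → x = y') →
      ∀ x ∈ S, ∀ y' ∈ S, (openGraph Z).Reachable x y' ↔ (openGraph Z').Reachable x y' := by
    intro Z Z' hZ hZ' x hx y' hy'
    constructor
    · intro h; rw [hZ x hx y' hy' h]
    · intro h; rw [hZ' x hx y' hy' h]
  have nondisc : ∀ {Z : BondConfig V}, ¬ (∀ x ∈ S, ∀ y' ∈ S, (openGraph Z).Reachable x y' → x = y') →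
      ∃ p ∈ S, ∃ p' ∈ S, p ≠ p' ∧ (openGraph Z).Reachable p p' := by
    intro Z h
    by_contra h'
    apply h
    intro x hx y' hy' hxy
    by_contra hne
    exact h' ⟨x, hx, y', hy', hne, hxy⟩
  -- two joining classes are too expensive: different classes …
  have cross : ∀ {X Y : BondConfig V} {EX EY : Set (Sym2 V)}, IsForestCfg X → IsForestCfg Y → Disjoint ES EX → Disjoint ES EY →
      ES.ncard + (ES ∩ u₀).ncard ≤ (X ∩ ES).ncard + (Y ∩ ES).ncard →
      ¬ (∀ x ∈ S, ∀ y' ∈ S, (openGraph (X ∩ EX)).Reachable x y' → x = y') →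
      ∀ x ∈ S, ∀ y' ∈ S, (openGraph (Y ∩ EY)).Reachable x y' → x = y' := by
    intro X Y EX EY hX hY hdX hdY hs hnX
    by_contra hnY
    obtain ⟨p, hp, p', hp', hne, hj⟩ := nondisc hnX
    obtain ⟨r, hr, r', hr', hne', hj'⟩ := nondisc hnY
    have a := gadget_ncard_add_two_le hES hdX hX hp hp' hne hj
    have b := gadget_ncard_add_two_le hES hdY hY hr hr' hne' hj'
    omega
  -- … and one class on both sides
  have same : ∀ {X Y : BondConfig V}, IsForestCfg X → IsForestCfg Y →
      ES.ncard + (ES ∩ u₀).ncard ≤ (X ∩ ES).ncard + (Y ∩ ES).ncard →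
      ¬ (∀ x ∈ S, ∀ y' ∈ S, (openGraph (X ∩ E₂)).Reachable x y' → x = y') →
      ∀ x ∈ S, ∀ y' ∈ S, (openGraph (X ∩ E₁)).Reachable x y' → x = y' := by
    intro X Y hX hY hs hn2
    by_contra hn1
    obtain ⟨r, hr, r', hr', hne', hj₂⟩ := nondisc hn2
    obtain ⟨p, hp, p', hp', hne, hj₁⟩ := nondisc hn1
    have a := gadget_ncard_add_three_le hES hd hd₁ hd₂ hX hp hp' hr hr' hne hne' hj₁ hj₂
    have b := ncard_add_one_le_of_inside (fun e he z hz => hES e he.2 z hz) (isForestCfg_of_subset hY inter_subset_left) hp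
    omega
  have hsum' : ES.ncard + (ES ∩ u₀).ncard ≤ ((ω ∆ M') ∩ ES).ncard + (ω ∩ ES).ncard := by omega
  by_cases hA2 : ∀ x ∈ S, ∀ y' ∈ S, (openGraph (ω ∩ E₂)).Reachable x y' → x = y'
  · by_cases hB2 : ∀ x ∈ S, ∀ y' ∈ S, (openGraph ((ω ∆ M') ∩ E₂)).Reachable x y' → x = y'
    · exact Or.inl (agree hA2 hB2)
    · -- `B₂` joins: `A₁` (different class) and `B₁` (same class) are discrete
      exact Or.inr (agree (cross hFB hF hd₂ hd₁ hsum' hB2) (same hFB hF hsum' hB2))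
  · -- `A₂` joins: `A₁` (same class) and `B₁` (different class) are discrete
    exact Or.inr (agree (same hF hFB hsum hA2) (cross hF hFB hd₂ hd₁ hsum hA2))

/-- **THE DENSE-SEPARATOR EQUALITY (all `|S|`).**  Fibre `(M ∪ {e, f}, u₀)`, `e = ov ∈ E₁`, `f = oy ∈ E₂`; sides `E₁` (pairs on `V₁`),
`E₂` (pairs on `V₂`) and gadget `ES` (pairs inside `S`) pairwise disjoint with `V₁ ∩ V₂ ⊆ S` (so `S ∋ o` separates `v` from `y`), all
pairs of the fibre in `ES ∪ E₁ ∪ E₂`, the gadget in the fibre, and DENSITY `2|S| ≤ |ES| + |ES ∩ u₀| + 3` (`S` spans at least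
`2|S| - 3` pairs of the fibre, doubled pairs counted twice).  Then `#(Fo ∩ {e, f ∈ ω}, Fo) = #(Fo ∩ {e ∈ ω}, Fo ∩ {f ∈ ω})`:
`P(e, f same colour) = 1/2` EXACTLY for the uniform forest 2-colouring.  The theorem of memo bschramm/FROM-fk-1-g19-ADVERSARIAL.md §2f
in full generality; `|S| = 1, 2, 3` are p323201, p328146, p329067; it explains every primitive equality of the node found by the
g18/g19 mining (`n ≤ 14`). [cite: SempleWelsh2008, Conj. 1.1 (p. 2)] [cite: Linusson2011, Prop. 2.6] [cite: Grimmett2006, §3.8 (pp. 61–62)] -/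
theorem adjForestNoSq_fibre_eq_of_denseSep (h₁ : ∀ e ∈ E₁, ∀ z ∈ e, z ∈ V₁) (h₂ : ∀ e ∈ E₂, ∀ z ∈ e, z ∈ V₂)
    (hES : ∀ e ∈ ES, ∀ z ∈ e, z ∈ S) (hS : V₁ ∩ V₂ ⊆ S)
    (hd : Disjoint E₁ E₂) (hd₁ : Disjoint ES E₁) (hd₂ : Disjoint ES E₂) (heE : s(o, v) ∈ E₁) (hfE : s(o, y) ∈ E₂)
    (hsub : insert s(o, y) (insert s(o, v) M) ∪ u₀ ⊆ ES ∪ (E₁ ∪ E₂))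
    (hESsub : ES ⊆ insert s(o, y) (insert s(o, v) M) ∪ u₀) (hdense : 2 * S.ncard ≤ ES.ncard + (ES ∩ u₀).ncard + 3) :
    fibreCount (insert s(o, y) (insert s(o, v) M)) u₀ (forestEv V ∩ {ω | s(o, v) ∈ ω ∧ s(o, y) ∈ ω}) (forestEv V) =
      fibreCount (insert s(o, y) (insert s(o, v) M)) u₀ (forestEv V ∩ {ω | s(o, v) ∈ ω}) (forestEv V ∩ {ω | s(o, y) ∈ ω}) :=
  adjForestNoSq_fibre_eq_of_sepTrace h₁ h₂ hES hS hd hd₁ hd₂ heE hfE hsub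
    (fun _ hω hF hFB => sepTrace_dichotomy_of_dense hES hd hd₁ hd₂ hESsub hdense hω hF hFB)

/-- **THE TIGHT-SET EQUALITY** (memo bschramm/FROM-fk-1-g18-VERTEX-NC.md §4c(ii), in the kernel).  Fibre `(M ∪ {e, f}, u₀)`, `e = ov ∈ E₁`,
`f = oy ∈ E₂`, `E₁` = the pairs inside a set `U` (so `o, v ∈ U`), `E₂` the other pairs (on `V₂` with `U ∩ V₂ ⊆ U`, e.g. `V₂ = V`; `y`
anywhere), `E₁ ∩ E₂ = ∅`, all pairs of the fibre in `E₁ ∪ E₂`, `E₁` in the fibre and TIGHT: `2|U| = |E₁| + |E₁ ∩ u₀| + 2` (`U` spans exactly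
`2|U| - 2` pairs, doubled pairs counted twice).  Then both side-1 classes of every valid colouring are spanning trees of `U` (equal,
indiscrete traces), and `#(Fo ∩ {e, f ∈ ω}, Fo) = #(Fo ∩ {e ∈ ω}, Fo ∩ {f ∈ ω})`. [cite: SempleWelsh2008, Conj. 1.1 (p. 2)]
[cite: Linusson2011, Prop. 2.6] [cite: Grimmett2006, §3.8 (pp. 61–62)] -/
theorem adjForestNoSq_fibre_eq_of_tightSet {U : Set V} (h₁ : ∀ e ∈ E₁, ∀ z ∈ e, z ∈ U) (h₂ : ∀ e ∈ E₂, ∀ z ∈ e, z ∈ V₂)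
    (hd : Disjoint E₁ E₂) (heE : s(o, v) ∈ E₁) (hfE : s(o, y) ∈ E₂)
    (hsub : insert s(o, y) (insert s(o, v) M) ∪ u₀ ⊆ E₁ ∪ E₂)
    (hE₁sub : E₁ ⊆ insert s(o, y) (insert s(o, v) M) ∪ u₀) (htight : 2 * U.ncard ≤ E₁.ncard + (E₁ ∩ u₀).ncard + 2) :
    fibreCount (insert s(o, y) (insert s(o, v) M)) u₀ (forestEv V ∩ {ω | s(o, v) ∈ ω ∧ s(o, y) ∈ ω}) (forestEv V) =
      fibreCount (insert s(o, y) (insert s(o, v) M)) u₀ (forestEv V ∩ {ω | s(o, v) ∈ ω}) (forestEv V ∩ {ω | s(o, y) ∈ ω}) := by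
  have hES : ∀ e ∈ (∅ : Set (Sym2 V)), ∀ z ∈ e, z ∈ U := fun e he => absurd he (Set.notMem_empty _)
  have hS : U ∩ V₂ ⊆ U := inter_subset_left
  have hsub' : insert s(o, y) (insert s(o, v) M) ∪ u₀ ⊆ ∅ ∪ (E₁ ∪ E₂) := by rw [empty_union]; exact hsub
  have ho : o ∈ U := h₁ _ heE o (Sym2.mem_mk_left _ _)
  refine adjForestNoSq_fibre_eq_of_sepTrace h₁ h₂ hES hS hd (Set.empty_disjoint _) (Set.empty_disjoint _) heE hfE hsub'
    (fun ω hω hF hFB => Or.inr ?_)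
  -- both side-1 classes are spanning trees of `U`
  have hsum := gadget_ncard_add_le (ES := E₁) hE₁sub hω
  have hA : ∀ e ∈ ω ∩ E₁, ∀ z ∈ e, z ∈ U := fun e he z hz => h₁ e he.2 z hz
  have hB : ∀ e ∈ (ω ∆ insert s(o, y) (insert s(o, v) M)) ∩ E₁, ∀ z ∈ e, z ∈ U := fun e he z hz => h₁ e he.2 z hz
  have hAF : IsForestCfg (ω ∩ E₁) := isForestCfg_of_subset hF inter_subset_left
  have hBF : IsForestCfg ((ω ∆ insert s(o, y) (insert s(o, v) M)) ∩ E₁) := isForestCfg_of_subset hFB inter_subset_left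
  have a := ncard_add_one_le_of_inside hA hAF ho
  have b := ncard_add_one_le_of_inside hB hBF ho
  intro x hx y' hy'
  exact ⟨fun _ => reachable_of_inside_of_ncard hB hBF (by omega) hx hy',
    fun _ => reachable_of_inside_of_ncard hA hAF (by omega) hx hy'⟩

end DenseSep

end FK

end Summit.CriticalPhenomena.PercolationContinuityZ3.Theorems

end
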